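import Mathlib.Analysis.Matrix.PosDef
import Literature.MathematicalPhysics.KineticTheory.HardSphereEulerProofs

/-!
# A Lipschitz, compactly supported dual family to finitely many velocity moments
(crux stmt-AtomisticToContinuum-14440 `TwoClocks.EquilibriumFastWindowLD`, line `birth`, stub L)

Helper file (`--supports stmt-AtomisticToContinuum-14440`) for the static Lipschitz reduction
`stub_lipschitzReduction` (`W_Lip → W`: the bounded-class normal form of the crux follows from its
restriction to Lipschitz observables). The reduction approximates an admissible observable by a
Lipschitz one and restores the Maxwellian orthogonality relations EXACTLY by subtracting a finite
correction `Σ_k d_k(x) ψ_k(v)`; for the corrected observable to stay Lipschitz the dual family `ψ_k`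
must be Lipschitz. This file provides it, by a Gram-matrix argument:

* `lipschitzReduction_dualFamily` — for `θ > 0`, `u ∈ ℝ³` and a finite family `e_i : ℝ³ → ℝ` of
  continuous functions, Lipschitz on the ball of radius `2` and linearly independent on the unit
  ball, there are continuous `ψ_i`, supported in `|v| ≤ 2`, uniformly Lipschitz and bounded, with
  `∫ ψ_i e_l M_{1,u,θ} dv = δ_{il}`. Construction: `φ_l = χ e_l` with the Lipschitz cutoff
  `χ(v) = max 0 (min 1 (2 - |v|))`; the Gram matrix `A_{kl} = ∫ χ e_k e_l M` is symmetric positive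
  definite (`xᵀAx = ∫ χ (Σ x_k e_k)² M > 0` for `x ≠ 0` by independence on the unit ball, where
  `χ = 1` and `M > 0`), hence invertible (`Matrix.PosDef.det_pos`), and `ψ = A⁻¹ φ`.

Elementary; no dynamics.
-/

noncomputable section

open MeasureTheory ProbabilityTheory Real Set Filter
open scoped ENNReal BigOperators

namespace Summit.AtomisticToContinuum.HydrodynamicLimit.Theorems.ClampedCorrectorBirth

open Literature.Analysis.FluidPDE Literature.MathematicalPhysics.KineticTheory

/-- The cutoff `χ(v) = max 0 (min 1 (2 - |v|))`: values in `[0, 1]`, `= 1` on the unit ball, `= 0`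
off the ball of radius `2`, and `1`-Lipschitz. [folklore] -/
private theorem cutoff_two_props :
    (∀ v : V3, 0 ≤ max 0 (min 1 (2 - ‖v‖)) ∧ max 0 (min 1 (2 - ‖v‖)) ≤ 1) ∧
    (∀ v : V3, ‖v‖ ≤ 1 → max 0 (min 1 (2 - ‖v‖)) = 1) ∧
    (∀ v : V3, 2 ≤ ‖v‖ → max 0 (min 1 (2 - ‖v‖)) = 0) ∧
    (∀ v v' : V3, |max 0 (min 1 (2 - ‖v‖)) - max 0 (min 1 (2 - ‖v'‖))| ≤ ‖v - v'‖) := by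
  refine ⟨fun v => ⟨le_max_left _ _, max_le zero_le_one (min_le_left _ _)⟩, fun v hv => ?_,
    fun v hv => ?_, fun v v' => ?_⟩
  · rw [min_eq_left (by linarith), max_eq_right zero_le_one]
  · exact max_eq_left ((min_le_right _ _).trans (by linarith))
  · have h1 := abs_max_sub_max_le_max (0 : ℝ) (min 1 (2 - ‖v‖)) 0 (min 1 (2 - ‖v'‖))
    have h2 := abs_min_sub_min_le_max (1 : ℝ) (2 - ‖v‖) 1 (2 - ‖v'‖)
    rw [sub_self, abs_zero, max_eq_right (abs_nonneg (min 1 (2 - ‖v‖) - min 1 (2 - ‖v'‖)))] at h1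
    rw [sub_self, abs_zero, max_eq_right (abs_nonneg (2 - ‖v‖ - (2 - ‖v'‖)))] at h2
    have h3 : |2 - ‖v‖ - (2 - ‖v'‖)| = |‖v‖ - ‖v'‖| := by
      rw [show (2 : ℝ) - ‖v‖ - (2 - ‖v'‖) = -(‖v‖ - ‖v'‖) by ring, abs_neg]
    rw [h3] at h2
    exact h1.trans (h2.trans (abs_norm_sub_norm_le v v'))

/-- A continuous function on `ℝ³` vanishing off the ball of radius `2` is integrable. [folklore] -/
private theorem integrable_of_vanish_two {f : V3 → ℝ} (hf : Continuous f)
    (h0 : ∀ v, 2 ≤ ‖v‖ → f v = 0) : Integrable f :=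
  hf.integrable_of_hasCompactSupport (HasCompactSupport.intro (isCompact_closedBall (0 : V3) 2)
    fun v hv => h0 v (by rw [Metric.mem_closedBall, dist_zero_right, not_le] at hv; exact hv.le))

/-- **A Lipschitz compactly supported dual family** (Gram-matrix construction). For `θ > 0`,
`u ∈ ℝ³` and a finite family of continuous `e_i : ℝ³ → ℝ`, Lipschitz on the ball of radius `2`
and linearly independent on the unit ball, there are continuous `ψ_i : ℝ³ → ℝ` vanishing for
`|v| ≥ 2`, uniformly Lipschitz and uniformly bounded, with `∫ ψ_i e_l M_{1,u,θ} = δ_{il}`: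
`ψ = A⁻¹ (χ e)` with `χ = max 0 (min 1 (2 - |v|))` and the positive definite Gram matrix
`A_{kl} = ∫ χ e_k e_l M_{1,u,θ}`. [folklore] -/
theorem lipschitzReduction_dualFamily :
    ∀ {ι : Type} [Fintype ι] [DecidableEq ι] {θ : ℝ}, 0 < θ → ∀ (u : V3) (e : ι → V3 → ℝ),
    (∀ i, Continuous (e i)) →
    (∃ Le : ℝ, ∀ i v v', ‖v‖ ≤ 2 → ‖v'‖ ≤ 2 → |e i v - e i v'| ≤ Le * ‖v - v'‖) →
    (∀ a : ι → ℝ, (∀ v : V3, ‖v‖ ≤ 1 → ∑ i, a i * e i v = 0) → a = 0) →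
    ∃ ψ : ι → V3 → ℝ, (∀ i, Continuous (ψ i)) ∧
      (∀ v : V3, 2 ≤ ‖v‖ → ∀ i, ψ i v = 0) ∧
      (∃ L : ℝ, ∀ i v v', |ψ i v - ψ i v'| ≤ L * ‖v - v'‖) ∧
      (∃ B : ℝ, ∀ i v, |ψ i v| ≤ B) ∧
      ∀ i l, ∫ v, ψ i v * e l v * localMaxwellian 1 θ u v = if i = l then 1 else 0 := by
  intro ι _ _ θ hθ u e he hLe hind
  obtain ⟨⟨hχ01, hχ1, hχ0, hχL⟩⟩ := And.intro cutoff_two_props trivial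
  obtain ⟨χ, hχ⟩ : ∃ χ : V3 → ℝ, χ = fun v => max 0 (min 1 (2 - ‖v‖)) := ⟨_, rfl⟩
  simp only [← show ∀ v, χ v = max 0 (min 1 (2 - ‖v‖)) from fun v => by rw [hχ]] at hχ01 hχ1 hχ0 hχL
  have hχc : Continuous χ := by rw [hχ]; fun_prop
  set M : V3 → ℝ := localMaxwellian 1 θ u with hM
  have hMc : Continuous M := continuous_localMaxwellian 1 θ u
  have hMp : ∀ v, 0 < M v := fun v => localMaxwellian_pos one_pos hθ u v
  -- the Lipschitz constant of `e` on the ball of radius `2`, made nonnegative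
  obtain ⟨Le, hLe0, hLe⟩ : ∃ L : ℝ, 0 ≤ L ∧
      ∀ i v v', ‖v‖ ≤ 2 → ‖v'‖ ≤ 2 → |e i v - e i v'| ≤ L * ‖v - v'‖ := by
    obtain ⟨L, hL⟩ := hLe
    exact ⟨max L 0, le_max_right _ _, fun i v v' hv hv' =>
      (hL i v v' hv hv').trans (mul_le_mul_of_nonneg_right (le_max_left _ _) (norm_nonneg _))⟩
  -- a uniform bound of `e` on the ball of radius `2`
  obtain ⟨Be, hBe0, hBe⟩ : ∃ B : ℝ, 0 ≤ B ∧ ∀ i v, ‖v‖ ≤ 2 → |e i v| ≤ B := by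
    choose C hC using fun i =>
      (isCompact_closedBall (0 : V3) 2).exists_bound_of_continuousOn (he i).continuousOn
    refine ⟨∑ i, |C i|, Finset.sum_nonneg fun i _ => abs_nonneg _, fun i v hv => ?_⟩
    have h := hC i v (by rwa [Metric.mem_closedBall, dist_zero_right])
    rw [Real.norm_eq_abs] at h
    exact (h.trans (le_abs_self _)).trans
      (Finset.single_le_sum (f := fun j => |C j|) (fun j _ => abs_nonneg _) (Finset.mem_univ i))
  -- the truncated family `φ_j = χ e_j`: bound and Lipschitz constant
  have hφB : ∀ j v, |χ v * e j v| ≤ Be := by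
    intro j v
    rcases le_or_gt ‖v‖ 2 with hv | hv
    · rw [abs_mul, abs_of_nonneg (hχ01 v).1]
      exact (mul_le_mul (hχ01 v).2 (hBe j v hv) (abs_nonneg _) zero_le_one).trans_eq (one_mul _)
    · rw [hχ0 v hv.le, zero_mul, abs_zero]; exact hBe0
  have hφL : ∀ j v v', |χ v * e j v - χ v' * e j v'| ≤ (Be + Le) * ‖v - v'‖ := by
    -- one point inside the ball of radius `2`, the other outside
    have hio : ∀ j v v', ‖v‖ ≤ 2 → 2 < ‖v'‖ →
        |χ v * e j v - χ v' * e j v'| ≤ (Be + Le) * ‖v - v'‖ := by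
      intro j v v' hv hv'
      rw [hχ0 v' hv'.le, zero_mul, sub_zero, abs_mul]
      have h1 : |χ v| ≤ ‖v - v'‖ := by
        have := hχL v v'; rwa [hχ0 v' hv'.le, sub_zero] at this
      calc |χ v| * |e j v| ≤ ‖v - v'‖ * Be :=
            mul_le_mul h1 (hBe j v hv) (abs_nonneg _) (norm_nonneg _)
        _ ≤ (Be + Le) * ‖v - v'‖ := by nlinarith [norm_nonneg (v - v')]
    intro j v v'
    rcases le_or_gt ‖v‖ 2 with hv | hv <;> rcases le_or_gt ‖v'‖ 2 with hv' | hv'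
    · calc |χ v * e j v - χ v' * e j v'|
            = |(χ v - χ v') * e j v + χ v' * (e j v - e j v')| := by ring_nf
        _ ≤ |χ v - χ v'| * |e j v| + |χ v'| * |e j v - e j v'| := by
            refine (abs_add_le _ _).trans ?_; rw [abs_mul, abs_mul]
        _ ≤ ‖v - v'‖ * Be + 1 * (Le * ‖v - v'‖) :=
            add_le_add (mul_le_mul (hχL v v') (hBe j v hv) (abs_nonneg _) (norm_nonneg _))
              (mul_le_mul (by rw [abs_of_nonneg (hχ01 v').1]; exact (hχ01 v').2)
                (hLe j v v' hv hv') (abs_nonneg _) zero_le_one)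
        _ = (Be + Le) * ‖v - v'‖ := by ring
    · exact hio j v v' hv hv'
    · rw [abs_sub_comm, norm_sub_rev]; exact hio j v' v hv' hv
    · rw [hχ0 v hv.le, hχ0 v' hv'.le, zero_mul, zero_mul, sub_zero, abs_zero]; positivity
  -- integrability of the Gram integrands
  have hI : ∀ k l, Integrable (fun v => χ v * e k v * e l v * M v) := fun k l =>
    integrable_of_vanish_two (by fun_prop) fun v hv => by simp [hχ0 v hv]
  -- the Gram matrix
  obtain ⟨A, hA⟩ : ∃ A : Matrix ι ι ℝ, ∀ k l, A k l = ∫ v, χ v * e k v * e l v * M v :=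
    ⟨Matrix.of fun k l => ∫ v, χ v * e k v * e l v * M v, fun k l => rfl⟩
  have hAh : A.IsHermitian := by
    refine Matrix.IsHermitian.ext fun i j => ?_
    rw [star_trivial, hA, hA]
    exact integral_congr_ae (ae_of_all _ fun v => by simp only; ring)
  have hApos : A.PosDef := by
    refine Matrix.PosDef.of_dotProduct_mulVec_pos hAh fun x hx => ?_
    have e1 : star x ⬝ᵥ (A.mulVec x) = ∑ i, x i * ∑ j, A i j * x j := by
      simp [dotProduct, Matrix.mulVec]
    have e2 : ∑ i, x i * ∑ j, A i j * x j = ∫ v, χ v * (∑ i, x i * e i v) ^ 2 * M v := by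
      have h : ∀ v, χ v * (∑ i, x i * e i v) ^ 2 * M v =
          ∑ i, ∑ j, x i * x j * (χ v * e i v * e j v * M v) := by
        intro v
        rw [sq, Finset.sum_mul_sum, Finset.mul_sum, Finset.sum_mul]
        refine Finset.sum_congr rfl fun i _ => ?_
        rw [Finset.mul_sum, Finset.sum_mul]
        exact Finset.sum_congr rfl fun j _ => by ring
      simp_rw [h]
      rw [integral_finsetSum _ fun i _ =>
        integrable_finsetSum _ fun j _ => (hI i j).const_mul (x i * x j)]
      refine Finset.sum_congr rfl fun i _ => ?_
      rw [integral_finsetSum _ fun j _ => (hI i j).const_mul (x i * x j), Finset.mul_sum]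
      refine Finset.sum_congr rfl fun j _ => ?_
      rw [integral_const_mul, hA]; ring
    rw [e1, e2]
    have hp : ∃ v, ‖v‖ ≤ 1 ∧ ∑ i, x i * e i v ≠ 0 := by
      by_contra h
      exact hx (hind x fun v hv => not_not.1 fun hne => h ⟨v, hv, hne⟩)
    obtain ⟨v₀, hv₀, hpv₀⟩ := hp
    have hpc : Continuous fun v => ∑ i, x i * e i v :=
      continuous_finsetSum _ fun i _ => continuous_const.mul (he i)
    refine integral_pos_of_integrable_nonneg_nonzero (x := v₀) (by fun_prop)
      (integrable_of_vanish_two (by fun_prop) fun v hv => by simp [hχ0 v hv])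
      (fun v => mul_nonneg (mul_nonneg (hχ01 v).1 (sq_nonneg _)) (hMp v).le) ?_
    rw [hχ1 v₀ hv₀, one_mul]
    exact mul_ne_zero (pow_ne_zero 2 hpv₀) (hMp v₀).ne'
  have hinv : A⁻¹ * A = 1 := Matrix.nonsing_inv_mul A hApos.det_pos.ne'.isUnit
  -- the dual family `ψ = A⁻¹ φ`
  obtain ⟨ψ, hψ⟩ : ∃ ψ : ι → V3 → ℝ, ∀ i v, ψ i v = ∑ j, A⁻¹ i j * (χ v * e j v) :=
    ⟨fun i v => ∑ j, A⁻¹ i j * (χ v * e j v), fun _ _ => rfl⟩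
  set S : ℝ := ∑ i, ∑ j, |A⁻¹ i j| with hS
  have hSi : ∀ i, ∑ j, |A⁻¹ i j| ≤ S := fun i =>
    Finset.single_le_sum (f := fun i => ∑ j, |A⁻¹ i j|)
      (fun i _ => Finset.sum_nonneg fun j _ => abs_nonneg _) (Finset.mem_univ i)
  refine ⟨ψ, fun i => ?_, fun v hv i => ?_, ⟨(Be + Le) * S, fun i v v' => ?_⟩,
    ⟨Be * S, fun i v => ?_⟩, fun i l => ?_⟩
  · -- continuity
    rw [show ψ i = fun v => ∑ j, A⁻¹ i j * (χ v * e j v) from funext (hψ i)]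
    exact continuous_finsetSum _ fun j _ => continuous_const.mul (hχc.mul (he j))
  · -- support
    simp [hψ, hχ0 v hv]
  · -- Lipschitz bound
    rw [hψ, hψ, ← Finset.sum_sub_distrib]
    calc |∑ j, (A⁻¹ i j * (χ v * e j v) - A⁻¹ i j * (χ v' * e j v'))|
        ≤ ∑ j, |A⁻¹ i j * (χ v * e j v) - A⁻¹ i j * (χ v' * e j v')| :=
          Finset.abs_sum_le_sum_abs _ _
      _ = ∑ j, |A⁻¹ i j| * |χ v * e j v - χ v' * e j v'| :=
          Finset.sum_congr rfl fun j _ => by rw [← mul_sub, abs_mul]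
      _ ≤ ∑ j, |A⁻¹ i j| * ((Be + Le) * ‖v - v'‖) :=
          Finset.sum_le_sum fun j _ => mul_le_mul_of_nonneg_left (hφL j v v') (abs_nonneg _)
      _ = (∑ j, |A⁻¹ i j|) * ((Be + Le) * ‖v - v'‖) := by rw [Finset.sum_mul]
      _ ≤ S * ((Be + Le) * ‖v - v'‖) := mul_le_mul_of_nonneg_right (hSi i) (by positivity)
      _ = (Be + Le) * S * ‖v - v'‖ := by ring
  · -- uniform bound
    rw [hψ]
    calc |∑ j, A⁻¹ i j * (χ v * e j v)| ≤ ∑ j, |A⁻¹ i j * (χ v * e j v)| :=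
          Finset.abs_sum_le_sum_abs _ _
      _ = ∑ j, |A⁻¹ i j| * |χ v * e j v| := Finset.sum_congr rfl fun j _ => abs_mul _ _
      _ ≤ ∑ j, |A⁻¹ i j| * Be :=
          Finset.sum_le_sum fun j _ => mul_le_mul_of_nonneg_left (hφB j v) (abs_nonneg _)
      _ = (∑ j, |A⁻¹ i j|) * Be := by rw [Finset.sum_mul]
      _ ≤ S * Be := mul_le_mul_of_nonneg_right (hSi i) hBe0
      _ = Be * S := mul_comm _ _
  · -- duality
    have h : (fun v => ψ i v * e l v * M v) =
        fun v => ∑ j, A⁻¹ i j * (χ v * e j v * e l v * M v) := by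
      funext v
      rw [hψ, Finset.sum_mul, Finset.sum_mul]
      exact Finset.sum_congr rfl fun j _ => by ring
    rw [h, integral_finsetSum _ fun j _ => (hI j l).const_mul _]
    simp_rw [integral_const_mul, ← hA]
    have h1 := congrFun (congrFun hinv i) l
    rwa [Matrix.mul_apply, Matrix.one_apply] at h1

end Summit.AtomisticToContinuum.HydrodynamicLimit.Theorems.ClampedCorrectorBirth

end
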